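import Mathlib.Topology.ContinuousMap.StoneWeierstrass
import Mathlib.Algebra.MvPolynomial.Monad
import Mathlib.Algebra.MvPolynomial.CommRing
import Mathlib.RingTheory.MvPolynomial.Basic
import Mathlib.LinearAlgebra.UnitaryGroup
import Mathlib.Analysis.Complex.Basic
import Mathlib.Topology.Instances.Matrix
import Mathlib.Topology.Algebra.Star.Unitary
import Literature.NumberTheory.Automorphic.LinearAlgebraicGroups
import HarnessLib

/-!
# Real polynomial functions on the unitary group `U(n)`

Topic `RepresentationTheory/CompactGroups`. Tools for Chevalley's theorem that a compact subgroup
of `U(n)` is cut out, inside `U(n)`, by the complex polynomials (in the matrix entries and `det⁻¹`)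
vanishing on it (`CompactMatrixGroupAlgebraic`). We work with the real algebra generated by the
`2n²` functions `U ↦ Re U_{ij}`, `U ↦ Im U_{ij}` on the compact space `U(n)`; to keep the file free
of definitions these generators enter every statement as a family
`gen : (n × n) ⊕ (n × n) → C(U(n), ℝ)` together with the hypotheses `hre`, `him` saying what they
are. Results (all proved):

* `subalgebra_aeval_range_separatesPoints` — the real polynomial functions separate the points of
  `U(n)` (so they are dense in `C(U(n), ℝ)`, Stone–Weierstrass);
* `totalDegree_bind₁_le_of_forall_le_one` — substituting polynomials of degree `≤ 1` does not raise
  the total degree (general `MvPolynomial` lemma);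
* `rightTranslatePoly` facts (`totalDegree_rightTranslatePoly_le`, `aeval_rightTranslatePoly_apply`):
  right translation `U ↦ U k` acts on the generators by explicit linear substitutions, hence
  (`comp_mulRight_mem_map_restrictTotalDegree`) preserves the finite-dimensional space of
  polynomial functions of degree `≤ d`;
* `exists_glPoly_eval_eq_aeval` — **complexification**: every real polynomial function `p` on `U(n)`
  is the restriction of a complex polynomial `Q` in the coordinates `x_{ij}, det⁻¹` of `GL n ℂ`
  (replace `conj U_{ij}` by `(U⁻¹)_{ji}`, a polynomial in the entries and `det⁻¹` by Cramer), i.e.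
  `Q(U) = p(U)` for unitary `U`.

Source: C. Chevalley, *Theory of Lie Groups I* (1946), Ch. VI §§VIII–IX (compact Lie groups are
algebraic); A. L. Onishchik, E. B. Vinberg, *Lie Groups and Algebraic Groups* (1990), Ch. 5 §2,
Thm. 5 and its proof. Mathlib: Stone–Weierstrass (`ContinuousMap.subalgebra_topologicalClosure_eq_top_of_separatesPoints`),
`MvPolynomial.restrictTotalDegree`; no "polynomial functions on a matrix group"
(`lean search 'unitaryGroup.*MvPolynomial|polynomial function.*unitary'`).
-/

noncomputable section

open scoped ComplexConjugate

namespace Literature.RepresentationTheory.CompactGroups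

open Literature.NumberTheory.Automorphic

/-! ### A degree bound for linear substitutions -/

section Degree

variable {σ τ R : Type*} [CommSemiring R]

/-- Substituting polynomials of total degree `≤ 1` for the variables does not increase the total
degree. [folklore] -/
theorem totalDegree_bind₁_le_of_forall_le_one (L : σ → MvPolynomial τ R)
    (hL : ∀ c, (L c).totalDegree ≤ 1) (q : MvPolynomial σ R) :
    (MvPolynomial.bind₁ L q).totalDegree ≤ q.totalDegree := by
  classical
  conv_lhs => rw [q.as_sum]
  rw [map_sum]
  refine MvPolynomial.totalDegree_finsetSum_le fun m hm => ?_
  rw [MvPolynomial.bind₁_monomial]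
  refine (MvPolynomial.totalDegree_mul _ _).trans ?_
  rw [MvPolynomial.totalDegree_C, zero_add]
  refine (MvPolynomial.totalDegree_finsetProd _ _).trans ?_
  refine le_trans (Finset.sum_le_sum fun c _ => (MvPolynomial.totalDegree_pow _ _).trans
    (Nat.mul_le_mul_left (m c) (hL c))) ?_
  simp only [mul_one]
  exact MvPolynomial.le_totalDegree hm

end Degree

/-! ### Polynomial functions on `U(n)` -/

variable {n : Type*} [Fintype n] [DecidableEq n]

/-! The real coordinates on `M_n(ℂ)` are indexed by `(n × n) ⊕ (n × n)`: `inl (i, j)` for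
`Re U_{ij}` and `inr (i, j)` for `Im U_{ij}`. -/


section Generators

variable (gen : ((n × n) ⊕ (n × n)) → C(Matrix.unitaryGroup n ℂ, ℝ))
  (hre : ∀ (i j : n) (U : Matrix.unitaryGroup n ℂ), gen (Sum.inl (i, j)) U = ((U : Matrix n n ℂ) i j).re)
  (him : ∀ (i j : n) (U : Matrix.unitaryGroup n ℂ), gen (Sum.inr (i, j)) U = ((U : Matrix n n ℂ) i j).im)

include hre him

/-- Evaluating a polynomial function at a point: `(p(gen))(U) = p(Re U, Im U)`. [folklore] -/
theorem aeval_gen_apply (p : MvPolynomial ((n × n) ⊕ (n × n)) ℝ) (U : Matrix.unitaryGroup n ℂ) :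
    MvPolynomial.aeval (R := ℝ) gen p U =
      MvPolynomial.eval (Sum.elim (fun ij : n × n => ((U : Matrix n n ℂ) ij.1 ij.2).re)
        (fun ij : n × n => ((U : Matrix n n ℂ) ij.1 ij.2).im)) p := by
  have h : MvPolynomial.aeval (R := ℝ) gen p U =
      ((ContinuousMap.evalAlgHom ℝ ℝ U).comp (MvPolynomial.aeval (R := ℝ) gen)) p := rfl
  have hfun : (fun c => gen c U) =
      Sum.elim (fun ij : n × n => ((U : Matrix n n ℂ) ij.1 ij.2).re)
        (fun ij : n × n => ((U : Matrix n n ℂ) ij.1 ij.2).im) := by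
    funext c
    rcases c with ⟨i, j⟩ | ⟨i, j⟩
    exacts [hre i j U, him i j U]
  rw [h, MvPolynomial.comp_aeval]
  change MvPolynomial.aeval (fun c => gen c U) p = _
  rw [hfun]
  rfl

/-- **The real polynomial functions separate the points of `U(n)`.** [folklore] -/
theorem subalgebra_aeval_range_separatesPoints :
    ((MvPolynomial.aeval (R := ℝ) gen).range : Subalgebra ℝ C(Matrix.unitaryGroup n ℂ, ℝ)).SeparatesPoints := by
  intro U V hUV
  have hne : (U : Matrix n n ℂ) ≠ (V : Matrix n n ℂ) := fun h => hUV (Subtype.ext h)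
  obtain ⟨i, j, hij⟩ : ∃ i j, (U : Matrix n n ℂ) i j ≠ (V : Matrix n n ℂ) i j := by
    by_contra h
    push Not at h
    exact hne (Matrix.ext fun i j => h i j)
  by_cases hreq : ((U : Matrix n n ℂ) i j).re = ((V : Matrix n n ℂ) i j).re
  · have himne : ((U : Matrix n n ℂ) i j).im ≠ ((V : Matrix n n ℂ) i j).im := fun h =>
      hij (Complex.ext hreq h)
    refine ⟨gen (Sum.inr (i, j)), ⟨gen (Sum.inr (i, j)), ⟨MvPolynomial.X (Sum.inr (i, j)),
      MvPolynomial.aeval_X _ _⟩, rfl⟩, ?_⟩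
    simpa [him] using himne
  · refine ⟨gen (Sum.inl (i, j)), ⟨gen (Sum.inl (i, j)), ⟨MvPolynomial.X (Sum.inl (i, j)),
      MvPolynomial.aeval_X _ _⟩, rfl⟩, ?_⟩
    simpa [hre] using hreq

/-! ### Right translations act by linear substitutions -/

omit [DecidableEq n] hre him in
/-- The linear substitution describing `U ↦ U k` on the real coordinates:
`Re (Uk)_{ij} = Σ_l (Re U_{il} Re k_{lj} - Im U_{il} Im k_{lj})`,
`Im (Uk)_{ij} = Σ_l (Re U_{il} Im k_{lj} + Im U_{il} Re k_{lj})` (an explicit polynomial of degree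
`≤ 1` in the variables, for each coordinate; stated as an existence to keep the file free of
definitions). [folklore] -/
theorem exists_rightTranslatePoly (k : Matrix n n ℂ) :
    ∃ L : ((n × n) ⊕ (n × n)) → MvPolynomial ((n × n) ⊕ (n × n)) ℝ, (∀ c, (L c).totalDegree ≤ 1) ∧
      (∀ (i j : n), L (Sum.inl (i, j)) = ∑ l : n,
        (MvPolynomial.C ((k l j).re) * MvPolynomial.X (Sum.inl (i, l)) -
          MvPolynomial.C ((k l j).im) * MvPolynomial.X (Sum.inr (i, l)))) ∧
      (∀ (i j : n), L (Sum.inr (i, j)) = ∑ l : n,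
        (MvPolynomial.C ((k l j).im) * MvPolynomial.X (Sum.inl (i, l)) +
          MvPolynomial.C ((k l j).re) * MvPolynomial.X (Sum.inr (i, l)))) := by
  classical
  have hdeg1 : ∀ (a : ℝ) (c : ((n × n) ⊕ (n × n))),
      (MvPolynomial.C a * MvPolynomial.X c : MvPolynomial ((n × n) ⊕ (n × n)) ℝ).totalDegree ≤ 1 := by
    intro a c
    refine (MvPolynomial.totalDegree_mul _ _).trans ?_
    rw [MvPolynomial.totalDegree_C, zero_add]
    exact (MvPolynomial.totalDegree_X (R := ℝ) c).le
  refine ⟨fun c => match c with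
    | Sum.inl ij => ∑ l : n, (MvPolynomial.C ((k l ij.2).re) * MvPolynomial.X (Sum.inl (ij.1, l)) -
        MvPolynomial.C ((k l ij.2).im) * MvPolynomial.X (Sum.inr (ij.1, l)))
    | Sum.inr ij => ∑ l : n, (MvPolynomial.C ((k l ij.2).im) * MvPolynomial.X (Sum.inl (ij.1, l)) +
        MvPolynomial.C ((k l ij.2).re) * MvPolynomial.X (Sum.inr (ij.1, l))),
    fun c => ?_, fun i j => rfl, fun i j => rfl⟩
  rcases c with ⟨i, j⟩ | ⟨i, j⟩
  · refine MvPolynomial.totalDegree_finsetSum_le fun l _ => ?_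
    refine (MvPolynomial.totalDegree_sub _ _).trans (max_le (hdeg1 _ _) (hdeg1 _ _))
  · refine MvPolynomial.totalDegree_finsetSum_le fun l _ => ?_
    refine (MvPolynomial.totalDegree_add _ _).trans (max_le (hdeg1 _ _) (hdeg1 _ _))

/-- The substitution `L` computes right translation on the generators:
`(L_c(gen))(U) = gen_c (U k)`. [folklore] -/
theorem aeval_rightTranslatePoly_apply (k : Matrix.unitaryGroup n ℂ) {L : ((n × n) ⊕ (n × n)) → MvPolynomial ((n × n) ⊕ (n × n)) ℝ}
    (hLl : ∀ (i j : n), L (Sum.inl (i, j)) = ∑ l : n,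
        (MvPolynomial.C (((k : Matrix n n ℂ) l j).re) * MvPolynomial.X (Sum.inl (i, l)) -
          MvPolynomial.C (((k : Matrix n n ℂ) l j).im) * MvPolynomial.X (Sum.inr (i, l))))
    (hLr : ∀ (i j : n), L (Sum.inr (i, j)) = ∑ l : n,
        (MvPolynomial.C (((k : Matrix n n ℂ) l j).im) * MvPolynomial.X (Sum.inl (i, l)) +
          MvPolynomial.C (((k : Matrix n n ℂ) l j).re) * MvPolynomial.X (Sum.inr (i, l))))
    (c : ((n × n) ⊕ (n × n))) (U : Matrix.unitaryGroup n ℂ) :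
    MvPolynomial.aeval (R := ℝ) gen (L c) U = gen c (U * k) := by
  rcases c with ⟨i, j⟩ | ⟨i, j⟩
  · rw [hLl, aeval_gen_apply gen hre him, hre, Submonoid.coe_mul, Matrix.mul_apply, Complex.re_sum]
    simp only [map_sum, map_sub, map_mul, MvPolynomial.eval_C, MvPolynomial.eval_X, Sum.elim_inl,
      Sum.elim_inr, Complex.mul_re]
    exact Finset.sum_congr rfl fun l _ => by ring
  · rw [hLr, aeval_gen_apply gen hre him, him, Submonoid.coe_mul, Matrix.mul_apply, Complex.im_sum]
    simp only [map_sum, map_add, map_mul, MvPolynomial.eval_C, MvPolynomial.eval_X, Sum.elim_inl,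
      Sum.elim_inr, Complex.mul_im]
    exact Finset.sum_congr rfl fun l _ => by ring

/-- **Right translation preserves the polynomial functions of degree `≤ d`.** For `q` of total
degree `≤ d` and `k ∈ U(n)`, the function `U ↦ (q(gen))(U k)` is again `q'(gen)` with `q'` of total
degree `≤ d` (namely `q' = q ∘ L`). [folklore] -/
theorem comp_mulRight_mem_map_restrictTotalDegree (d : ℕ) (k : Matrix.unitaryGroup n ℂ) {q : MvPolynomial ((n × n) ⊕ (n × n)) ℝ}
    (hq : q ∈ MvPolynomial.restrictTotalDegree ((n × n) ⊕ (n × n)) ℝ d) :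
    (MvPolynomial.aeval (R := ℝ) gen q).comp ⟨fun U : Matrix.unitaryGroup n ℂ => U * k, continuous_mul_const k⟩ ∈
      Submodule.map (MvPolynomial.aeval (R := ℝ) gen).toLinearMap
        (MvPolynomial.restrictTotalDegree ((n × n) ⊕ (n × n)) ℝ d) := by
  obtain ⟨L, hL1, hLl, hLr⟩ := exists_rightTranslatePoly (n := n) (k : Matrix n n ℂ)
  refine ⟨MvPolynomial.bind₁ L q, ?_, ?_⟩
  · simp only [SetLike.mem_coe, MvPolynomial.mem_restrictTotalDegree] at hq ⊢
    exact (totalDegree_bind₁_le_of_forall_le_one L hL1 q).trans hq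
  · change MvPolynomial.aeval (R := ℝ) gen (MvPolynomial.bind₁ L q) = _
    rw [MvPolynomial.aeval_bind₁]
    ext U
    change ((ContinuousMap.evalAlgHom ℝ ℝ U).comp
      (MvPolynomial.aeval fun c => MvPolynomial.aeval (R := ℝ) gen (L c))) q =
      ((ContinuousMap.evalAlgHom ℝ ℝ (U * k)).comp (MvPolynomial.aeval (R := ℝ) gen)) q
    rw [MvPolynomial.comp_aeval, MvPolynomial.comp_aeval]
    congr 2
    funext c
    exact aeval_rightTranslatePoly_apply gen hre him k hLl hLr c U

/-! ### Complexification: real polynomial functions are restrictions of `GL n ℂ`-polynomials -/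

/-- **Complexification of a real polynomial function on `U(n)`.** For every real polynomial `p`
in `Re U_{ij}, Im U_{ij}` there is a complex polynomial `Q` in the coordinates `x_{ij}, det⁻¹` of
`GL n ℂ` with `Q(U) = p(U)` for all unitary `U`: substitute `Re x_{ij} ↦ (x_{ij} + y_{ji})/2`,
`Im x_{ij} ↦ (x_{ij} - y_{ji})/(2i)` where `y = x⁻¹` (polynomial in `x` and `det⁻¹` by Cramer,
the tree's `invPolyGL`), and use `U⁻¹ = U⋆` on `U(n)` (Chevalley 1946, Ch. VI §IX; Onishchik–Vinberg
Ch. 5 §2). [folklore] -/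
theorem exists_glPoly_eval_eq_aeval (p : MvPolynomial ((n × n) ⊕ (n × n)) ℝ) :
    ∃ Q : MvPolynomial (GLCoord n) ℂ, ∀ U : Matrix.unitaryGroup n ℂ,
      MvPolynomial.eval (glCoordFun (Unitary.toUnits U)) Q = ((MvPolynomial.aeval (R := ℝ) gen p U : ℝ) : ℂ) := by
  classical
  -- the complex substitution for the real coordinates
  let cg : ((n × n) ⊕ (n × n)) → MvPolynomial (GLCoord n) ℂ := fun c => match c with
    | Sum.inl ij => MvPolynomial.C (1 / 2 : ℂ) *
        (MvPolynomial.X (Sum.inl ij) + invPolyGL (Sum.inl (ij.2, ij.1)))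
    | Sum.inr ij => MvPolynomial.C (-Complex.I / 2) *
        (MvPolynomial.X (Sum.inl ij) - invPolyGL (Sum.inl (ij.2, ij.1)))
  refine ⟨MvPolynomial.bind₁ cg (MvPolynomial.map (algebraMap ℝ ℂ) p), fun U => ?_⟩
  -- the inverse of a unitary `U` in `GL n ℂ` is `U⋆`
  have hinv : ∀ i j : n, glCoordFun (Unitary.toUnits U)⁻¹ (Sum.inl (j, i)) =
      conj ((U : Matrix n n ℂ) i j) := by
    intro i j
    rw [glCoordFun_inl, Unitary.val_inv_toUnits_apply]
    change (star (U : Matrix n n ℂ)) j i = _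
    rw [Matrix.star_apply]
    rfl
  have hcg : ∀ c, MvPolynomial.eval (glCoordFun (Unitary.toUnits U)) (cg c) =
      ((Sum.elim (fun ij : n × n => ((U : Matrix n n ℂ) ij.1 ij.2).re)
        (fun ij : n × n => ((U : Matrix n n ℂ) ij.1 ij.2).im) c : ℝ) : ℂ) := by
    intro c
    rcases c with ⟨i, j⟩ | ⟨i, j⟩
    · simp only [cg, map_mul, MvPolynomial.eval_C, map_add, MvPolynomial.eval_X, eval_invPolyGL,
        hinv, glCoordFun_inl, Unitary.val_toUnits_apply, Sum.elim_inl, Complex.add_conj]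
      push_cast
      ring
    · simp only [cg, map_mul, MvPolynomial.eval_C, map_sub, MvPolynomial.eval_X, eval_invPolyGL,
        hinv, glCoordFun_inl, Unitary.val_toUnits_apply, Sum.elim_inr, Complex.sub_conj]
      push_cast
      ring_nf
      rw [Complex.I_sq]
      ring
  rw [eval_bind₁, MvPolynomial.eval_map, aeval_gen_apply gen hre him]
  have hfun : (fun c => MvPolynomial.eval (glCoordFun (Unitary.toUnits U)) (cg c)) =
      (algebraMap ℝ ℂ) ∘ (Sum.elim (fun ij : n × n => ((U : Matrix n n ℂ) ij.1 ij.2).re)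
        (fun ij : n × n => ((U : Matrix n n ℂ) ij.1 ij.2).im)) := funext hcg
  rw [hfun]
  have h3 := MvPolynomial.eval₂_comp_left (algebraMap ℝ ℂ) (RingHom.id ℝ)
    (Sum.elim (fun ij : n × n => ((U : Matrix n n ℂ) ij.1 ij.2).re)
      (fun ij : n × n => ((U : Matrix n n ℂ) ij.1 ij.2).im)) p
  rw [RingHom.comp_id] at h3
  exact h3.symm

end Generators

/-- **The generators exist**: the family of real coordinate functions `Re U_{ij}`, `Im U_{ij}` on
`U(n)` (continuous), packaged as an existence statement. [folklore] -/
theorem exists_gen : ∃ gen : ((n × n) ⊕ (n × n)) → C(Matrix.unitaryGroup n ℂ, ℝ),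
    (∀ (i j : n) (U : Matrix.unitaryGroup n ℂ), gen (Sum.inl (i, j)) U = ((U : Matrix n n ℂ) i j).re) ∧
    (∀ (i j : n) (U : Matrix.unitaryGroup n ℂ), gen (Sum.inr (i, j)) U = ((U : Matrix n n ℂ) i j).im) := by
  refine ⟨fun c => match c with
    | Sum.inl ij => ⟨fun U : Matrix.unitaryGroup n ℂ => ((U : Matrix n n ℂ) ij.1 ij.2).re, ?_⟩
    | Sum.inr ij => ⟨fun U : Matrix.unitaryGroup n ℂ => ((U : Matrix n n ℂ) ij.1 ij.2).im, ?_⟩,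
    fun i j U => rfl, fun i j U => rfl⟩
  · exact Complex.continuous_re.comp
      ((Continuous.matrix_elem continuous_subtype_val ij.1 ij.2))
  · exact Complex.continuous_im.comp
      ((Continuous.matrix_elem continuous_subtype_val ij.1 ij.2))

end Literature.RepresentationTheory.CompactGroups

end
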